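import Summits.QuantumFields.BalabanUV.Beta.GAN24.Lin4Additive
import Summits.QuantumFields.BalabanUV.Beta.GAN24.WSlotT2OfPieces
import Summits.QuantumFields.BalabanUV.Beta.SecondOrderRemainderTables
import Summits.QuantumFields.BalabanUV.Beta.TameKernelCalculus
import Summits.QuantumFields.BalabanUV.Gaps.CapTailPinnedLimitSign
import Literature.MathematicalPhysics.QuantumFieldTheory.Balaban1983to89.Beta.ScalewiseWitness

/-!
# `BalabanUV.Gaps.D1PinnedBorderWeightAffine` — cell pub-balaban-gaps, row (D1), seat g1-p1: THE PINNED LITERAL's ONE-LOOP COEFFICIENTS ARE AFFINE IN THE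
# FREE SECOND-ORDER BORDER WEIGHT `cB` — the hypothesis `haff` of `Gaps/D1PinnedBorderWeightSocket` DISCHARGED, hypothesis-free — HENCE (D1) AT THE β-LEAD's
# PINNED LITERAL `JsBalAn1` IS EITHER `cB`-BLIND OR, FOR EVERY NUMERAL, MET BY EXACTLY ONE BORDER WEIGHT

HONEST FRAMING (cell rule, page 1 of everything): [folklore] kernel algebra and real-sequence bookkeeping BY NAME over tree theorems — an2's recursion `BalabanStepW2.T2Of`
∕ `WbalOf` ∕ `e4OfW` ∕ `T2Of_loc` ∕ `vertexFamily₂_WbalOf'`, an4's `OneStepKernelFamily.decays_KInvStep` ∕ `hTA_TbalOf`, gan24's affinity letters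
`GAN24.T2RecursionAffine.W2SymOfK_eq_add_vsym` ∕ `K3OfK_eq_sub_of_W` ∕ `lin4` and `GAN24.Lin4Additive.lin4_add` ∕ `lin4_smul` ∕ `vsym_add` ∕ `vsym_smul`,
asym1's ∕ the β sub-cell's `TameKernelCalculus.tadpole_add`, `KernelReflection.tadpole_smul`, `ScalewiseWitness.secondMoment_add` ∕ `secondMoment_smul` ∕
`absMoment₂_const_mul`, an1's closed form `MixedJetTablesPlug.TbalOf_JsBalAn1`, and g1-p3's hypothesis-free `CapTailPinnedLimitSign.tendsto_pinned` ∕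
`d1Drift_pinned_iff_lim_eq` (gan24-p1's rate).  NOTHING of Bałaban's is asserted beyond print; [Balaban1987RG1] Thm 2 is UNPROVED IN PRINT; NOTHING here says which
border weight is print's ((P6) «colour constants pinned LAST» is the β-lead's ∕ an2's decision) nor whether the literal's limit actually depends on `cB` (the BLIND
∕ GENERIC alternative is NOT decided); 0 coefficients certified; (D1) NOT discharged at any literal; 0∕4 row-D1 binders; NOT `BetaPertH`, NOT the continuum limit,
NOT Clay.  HONEST DEPENDENCY (b2b cell, verbatim): «continuum YM on T⁴ ⇐ BetaPertH ∧ nine spine estimates (0/9 proved); BetaPertH ⇐ (D1) ∧ (D4) ∧ CAP+tail;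
G-an2-4 gates asym, D1 and NE2/3/4.»

WHY (row (D1); census row 62 (a) of `HOME/g1/RESIDUE.md` part (D1), RESIDUE v2.10: the successor's RECOMMENDED NEXT, done in the same session).  `Gaps/D1PinnedBorderWeightSocket`
(this seat, GEN 9) kernel-checked what follows from ONE displayed hypothesis `haff` — step-wise affinity of the pinned literal's one-loop coefficients in the border
weight `cB` of `MixedJetTablesPlug.JsBalAn1 hLc hr cE cVH cΛ cE₂ cB Tc` —: the limit is affine in `cB`, and «(D1) at the pinned literal» is either `cB`-blind or a
DEFINITION of `cB`.  THIS FILE PROVES `haff` (for every `cE₂`, not only the pin) and restates the consequences WITHOUT hypothesis.  The mechanism: `cB` enters the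
step kernels ONLY through an2's recursive bi-stencil family (`T2Of_zero`: `cE₂•wilsonW₂ Tc + cB•mfNeg ∘ vh₂S`; `T2Of_succ`: `cE₂·wV4 • e4OfW j (Spure j) (M1 j)
(WbalOf … (T2Of …) … j) + cB·wB2 • mfNeg ∘ vh₂S`); the read-out `e4OfW` of the assembled member is its `T₂`-FREE part plus gan24's LINEAR map `lin4 1 (KInvStep Lc j) Lc`
of the bi-stencil slot (§1); so by induction every member `T2Of … cB … j` is the affine combination `(1 − cB)•T2Of … 0 … j + cB•T2Of … 1 … j` (§2), hence so is the
assembled second-order family (§3, `vsym` additive on bounded tables), hence — the first-order stencils and an4's `KInvStep` being `cB`-free and `hessKer` affine in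
its W-slot — so are the step kernels of `JsBalAn1` entrywise and their (1.22) second moments (§4).  The rest (§5) is §1 of the socket file with `haff` supplied.

CONTENT (all [folklore]; no `def`, no `def … : Prop`, nothing cited as a hypothesis, 0 sorry):
* §1 (generic `d`, `1 ≤ Lc`, any `LocStencil₂` bi-stencil family `T₂`, any `LocStencilFM` mixed table) **`e4OfW_WbalOf_eq_base_add_lin4`** — the value-4-jet read-out of
  `WbalOf … T₂ … j` is that of `WbalOf … 0 … j` plus `lin4 1 (KInvStep Lc j) Lc (T₂ j)` (`K3OfK_eq_sub_of_W` at a common rate, `mmRead_sub`).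
* §2 `abs_smul_le_of_locStencil₂`; **`T2Of_borderWeight_affine`** — `∀ j, T2Of d Lc cE cVH cΛ cE₂ cB T B mixFF j = (1 − cB)•T2Of … 0 … j + cB•T2Of … 1 … j`
  (any border table `B` with a `LocStencil₂` certificate, any `cE₂`).
* §3 **`WbalOf_T2Of_borderWeight_affine`** — the same for an2's assembled second-order family.
* §4 (generic) **`hessKer_affine_W`**; (`d = 3`, any box root, any `cE₂`) `JsBal0Of_S_indep`, **`TbalOf_JsBalAn1_borderWeight_affine`** (entrywise),
  **`secondMoment_JsBalAn1_borderWeight_affine`** — `β⁰_j(cB) = (1 − cB)·β⁰_j(0) + cB·β⁰_j(1)` for every `j`, channel: THE SOCKET's `haff`, PROVED.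
* §5 (the pin `cE₂ := Lc^8`, `2 ≤ Lc`, hypothesis-free): **`lim_JsBalAn1_borderWeight_affine`** — `lim β⁰(cB) = (1 − cB)·lim β⁰(0) + cB·lim β⁰(1)`;
  **`d1Drift_JsBalAn1_iff_zero_of_blind`** (BLIND case `ℓ₁ = ℓ₀`: (D1) does not see `cB`); **`exists_borderWeight_lim_eq`** (GENERIC case `ℓ₁ ≠ ℓ₀`: the limit takes
  EVERY real value along the `cB`-line); **`existsUnique_borderWeight_d1Drift`** (GENERIC case: for EVERY numeral `N` EXACTLY ONE border weight meets (D1),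
  `cB⋆ = (stepBal N Lc − ℓ₀)∕(ℓ₁ − ℓ₀)`); **`exists_borderWeight_limPos_and_limNeg`** (GENERIC case: the END bit `0 < lim β⁰` — the T⁴ headline's β-binder at this
  literal, `Gaps/D1PinnedLimitClosedForm.continuumYM4Torus_of_closedForm_pos` — is met by some border weight and missed by another).
READING (zero classification weight): as long as the second-order border weight is a free real of the literal, «(D1) holds at the β-lead's pinned literal» is EITHER
independent of it OR ONE AFFINE EQUATION that DEFINES it — so its evidential weight for the wall is exactly the weight of print's value of `cB` ((P6)).  Which alternative
holds is the single real comparison `lim β⁰(cB := 1) = lim β⁰(cB := 0)` — OPEN, a computation.  The verbatim analogue for an3's position table `Tc` (entering only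
`wilsonW₂ Tc`, linearly) is the same algebra and is NOT typed here.

ABSOLUTE RULE (cell charter, verbatim): «No internally-minted statement may enter as a cited fact. Every hypothesis is either kernel-proved in this
package or a verbatim quotation of a PUBLISHED theorem with page reference. The manuscript(s) under audit are NOT citable for their own disputed
steps — they are the thing under adjudication; programme-internal (2001/route/tribunal) claims are never citable.»

Provenance: cell pub-balaban-gaps, seat g1-p1 GEN 9 (prover-pub-balaban-gaps-g1-p1-g9-0), 2026-08-23; imports gan24's `GAN24.Lin4Additive` ∕ `GAN24.WSlotT2OfPieces`, the β
sub-cell's `SecondOrderRemainderTables` ∕ `TameKernelCalculus`, g1-p3's `Gaps/CapTailPinnedLimitSign`, and the Literature `Beta.ScalewiseWitness` ONLY; every tree theorem used BY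
NAME; no existing file touched; independent of the other GEN 9 files (the socket file's consequences are re-derived here in five lines each rather than imported,
because today's modules have no olean on the farm).
-/

noncomputable section

open Finset
open scoped BigOperators
open Literature.MathematicalPhysics.QuantumFieldTheory
open Literature.MathematicalPhysics.QuantumFieldTheory.Balaban1983to89
open Literature.MathematicalPhysics.QuantumFieldTheory.Balaban1983to89.Beta
open ExpKernelCalculus (MKer Decays BiLoc VertexFamily₂ comp)
open OneStepResolventKernel (Fib decays_mono biLoc_mono)
open OneStepKernelFamily (KInvStep decays_KInvStep)
open SecondOrderResponse (W2SymOfK LocStencilFM)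
open BalabanCompositeJets (LocStencil₂)
open BalabanStepJetsSucc (mmRead)
open BalabanStepW2 (Spure M1 M2Of WbalOf T2Of T2Of_zero T2Of_succ T2Of_loc e4OfW K3OfK wV4 wB2 vertexFamily₂_WbalOf')
open StepJetData (mfNeg)
open WilsonBiStencil (wilsonW₂)
open Summit.QuantumFields.BalabanUV.Beta.GAN24.ThirdJetKernel (mmRead_sub)
open Summit.QuantumFields.BalabanUV.Beta.GAN24.T2RecursionAffine (vsym lin4 lin4_apply W2SymOfK_eq_add_vsym K3OfK_eq_sub_of_W)
open Summit.QuantumFields.BalabanUV.Beta.GAN24.Lin4Additive (lin4_add lin4_smul vsym_add vsym_smul)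
open Summit.QuantumFields.BalabanUV.Beta.GAN24.WSlotT2OfPieces (locStencil₂_zero)
open Summit.QuantumFields.BalabanUV.Beta.SecondOrderRemainderTables (abs_le_of_locStencil₂)
open Filter Topology
open ExpKernelCalculus (hessKer tadpole)
open AffineAveraging (box toSite)
open AveragingMixedJetTables (vh₂SAt mixFFAt)
open OneStepKernelFamily (TbalOf D1Drift hTA_TbalOf)
open RateCertificate (CauchyRate)
open AxialDressing (axDressK axVertexOfK decays_axDressK)
open BalabanStepJetsSucc (JsBal0Of)
open BalabanStepW2 (WbalT2Of CwOf δwOf δwOf_pos WbalOf_loc₂)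
open KernelReflection (tadpole_smul)
open ScalewiseWitness (secondMoment_add secondMoment_smul absMoment₂_const_mul)
open Summit.QuantumFields.BalabanUV.Beta.TameKernelCalculus (Spr Loc tadpole_add)
open Summit.QuantumFields.BalabanUV.Beta.MixedJetTablesPlug (JsBalAn1 TbalOf_JsBalAn1 hB_an1 hmix_an1)
open Summit.QuantumFields.BalabanUV.Beta.GAN24.StencilSlotOfE3 (one_le_of_two_le)
open Summit.QuantumFields.BalabanUV.Gaps.CapTailPinnedLimitSign (tendsto_pinned d1Drift_pinned_iff_lim_eq)

namespace Summit.QuantumFields.BalabanUV.Gaps.D1PinnedBorderWeightAffine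

variable {d : ℕ} {Lc : ℕ} [NeZero Lc]

/-! ## §1 The value-4-jet read-out of the assembled second-order member: base part plus `lin4 1` of the bi-stencil slot -/

/-- [folklore] **THE READ-OUT IS THE BASE PART PLUS `lin4 1` OF THE BI-STENCIL TABLE**: for any scale-indexed bi-stencil family `T₂` with `LocStencil₂` members, a
`LocStencilFM` mixed table and `1 ≤ Lc`, at every level `j` and every pair of coarse bonds,
`e4OfW j (Spure j) (M1 j) (WbalOf … T₂ … j) b b′ = e4OfW j (Spure j) (M1 j) (WbalOf … 0 … j) b b′ + lin4 1 (KInvStep Lc j) Lc (T₂ j) b b′`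
(`W2SymOfK_eq_add_vsym` + `K3OfK_eq_sub_of_W` at a common rate + `mmRead_sub`; the certificates are an4's `decays_KInvStep` and an2's `vertexFamily₂_WbalOf'`). -/
theorem e4OfW_WbalOf_eq_base_add_lin4 (hLc : 1 ≤ Lc) (cE cVH cΛ : ℝ)
    {T₂ : ℕ → Fin (d + 1) → (Fin (d + 1) → ℤ) → Fin (d + 1) → (Fin (d + 1) → ℤ) → MKer (d + 1) (Fib d)}
    (hT₂ : ∀ j, ∃ C δ : ℝ, 0 < δ ∧ LocStencil₂ (T₂ j) C δ)
    {mixFF : Fin (d + 1) → (Fin (d + 1) → ℤ) → Fin (d + 1) → (Fin (d + 1) → ℤ) → MKer (d + 1) (Fib d)}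
    (hmix : ∃ C δ : ℝ, 0 < δ ∧ LocStencilFM Lc mixFF C δ) (j : ℕ)
    (κ : Fin (d + 1)) (u : Fin (d + 1) → ℤ) (κ' : Fin (d + 1)) (u' : Fin (d + 1) → ℤ) :
    e4OfW d Lc j (Spure d Lc cE cVH cΛ j) (M1 d Lc cΛ j) (WbalOf d Lc cE cVH cΛ T₂ mixFF j) κ u κ' u' =
      e4OfW d Lc j (Spure d Lc cE cVH cΛ j) (M1 d Lc cΛ j) (WbalOf d Lc cE cVH cΛ (fun _ => 0) mixFF j) κ u κ' u' +
        lin4 1 (KInvStep (d := d) Lc j) Lc (T₂ j) κ u κ' u' := by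
  obtain ⟨δK, CK, hδK, hCK, hK⟩ := decays_KInvStep (Lc := Lc) (d := d) j
  have h0 : ∀ j, ∃ C δ : ℝ, 0 < δ ∧ LocStencil₂ ((fun _ : ℕ => (0 : Fin (d + 1) → (Fin (d + 1) → ℤ) → Fin (d + 1) → (Fin (d + 1) → ℤ) →
      MKer (d + 1) (Fib d))) j) C δ := fun _ => ⟨0, 1, one_pos, locStencil₂_zero 1⟩
  obtain ⟨Cw, δw, hδw, hW⟩ := vertexFamily₂_WbalOf' (d := d) hLc cE cVH cΛ hT₂ hmix j
  obtain ⟨Cw₀, δw₀, hδw₀, hW₀⟩ := vertexFamily₂_WbalOf' (d := d) hLc cE cVH cΛ h0 hmix j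
  -- common rate
  set m : ℝ := min δK (min δw δw₀) with hm
  have hm0 : 0 < m := lt_min hδK (lt_min hδw hδw₀)
  have hKm : Decays (KInvStep (d := d) Lc j) CK m := decays_mono hK hCK le_rfl (min_le_left _ _)
  have hCw : 0 ≤ Cw := (hW 0 0 0 0).nonneg (Sum.inl 0)
  have hCw₀ : 0 ≤ Cw₀ := (hW₀ 0 0 0 0).nonneg (Sum.inl 0)
  have hb : BiLoc (WbalOf d Lc cE cVH cΛ T₂ mixFF j κ u κ' u') ((Lc : ℤ) • u) ((Lc : ℤ) • u') Cw m :=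
    biLoc_mono (hW κ u κ' u') hCw ((min_le_right _ _).trans (min_le_left _ _))
  have hb₀ : BiLoc (WbalOf d Lc cE cVH cΛ (fun _ => 0) mixFF j κ u κ' u') ((Lc : ℤ) • u) ((Lc : ℤ) • u') Cw₀ m :=
    biLoc_mono (hW₀ κ u κ' u') hCw₀ ((min_le_right _ _).trans (min_le_right _ _))
  have hsplit : WbalOf d Lc cE cVH cΛ T₂ mixFF j = WbalOf d Lc cE cVH cΛ (fun _ => 0) mixFF j + vsym (KInvStep (d := d) Lc j) Lc (T₂ j) :=
    W2SymOfK_eq_add_vsym (KInvStep (d := d) Lc j) Lc _ _ _ _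
  have hdiff : WbalOf d Lc cE cVH cΛ T₂ mixFF j κ u κ' u' - WbalOf d Lc cE cVH cΛ (fun _ => 0) mixFF j κ u κ' u' =
      vsym (KInvStep (d := d) Lc j) Lc (T₂ j) κ u κ' u' := by
    rw [hsplit]; simp only [Pi.add_apply, add_sub_cancel_left]
  unfold BalabanStepW2.e4OfW
  rw [K3OfK_eq_sub_of_W hKm hm0 Lc _ _ hb hb₀, hdiff, mmRead_sub, lin4_apply, one_smul]
  abel

/-! ## §2 an2's recursive bi-stencil family is AFFINE in the border weight `cB` -/

/-- [folklore] Entrywise bound of a scaled `LocStencil₂` table. -/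
theorem abs_smul_le_of_locStencil₂ (r : ℝ) {S₂ : Fin (d + 1) → (Fin (d + 1) → ℤ) → Fin (d + 1) → (Fin (d + 1) → ℤ) → MKer (d + 1) (Fib d)}
    {C δ : ℝ} (h : LocStencil₂ S₂ C δ) (hδ : 0 ≤ δ) {B : ℝ} (hB : |r| * C ≤ B)
    (κ : Fin (d + 1)) (u : Fin (d + 1) → ℤ) (κ' : Fin (d + 1)) (u' x z : Fin (d + 1) → ℤ) (a b : Fib d) :
    |(r • S₂) κ u κ' u' x z a b| ≤ B := by
  have h1 := abs_le_of_locStencil₂ h hδ κ u κ' u' x z a b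
  simp only [Pi.smul_apply, smul_eq_mul, abs_mul]
  exact (mul_le_mul_of_nonneg_left h1 (abs_nonneg r)).trans hB

/-- [folklore] **`T2Of` IS AFFINE IN THE SECOND-ORDER BORDER WEIGHT**: for `1 ≤ Lc`, a `LocStencil₂` border table `B`, a `LocStencilFM` mixed table and ANY
other data, at every level `j`,
`T2Of d Lc cE cVH cΛ cE₂ cB T B mixFF j = (1 − cB) • T2Of … 0 … j + cB • T2Of … 1 … j`
— member `0` by algebra; member `j+1` from §1 (the read-out is base + `lin4 1` of the previous member), `Lin4Additive.lin4_add ∕ lin4_smul` on the bounded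
tables `(1 − cB) • T2Of … 0 … j`, `cB • T2Of … 1 … j` (`T2Of_loc`), and the border term `cB·wB2 • mfNeg ∘ B`, itself affine in `cB`. -/
theorem T2Of_borderWeight_affine (hLc : 1 ≤ Lc) (cE cVH cΛ cE₂ cB : ℝ) (T : Fin 4 → Fin 4 → Fin 4 → Fin 4 → ℝ)
    {B : Fin (d + 1) → (Fin (d + 1) → ℤ) → Fin (d + 1) → (Fin (d + 1) → ℤ) → MKer (d + 1) (Fib d)}
    (hB : ∃ C δ : ℝ, 0 < δ ∧ LocStencil₂ B C δ)
    {mixFF : Fin (d + 1) → (Fin (d + 1) → ℤ) → Fin (d + 1) → (Fin (d + 1) → ℤ) → MKer (d + 1) (Fib d)}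
    (hmix : ∃ C δ : ℝ, 0 < δ ∧ LocStencilFM Lc mixFF C δ) :
    ∀ j : ℕ, T2Of d Lc cE cVH cΛ cE₂ cB T B mixFF j =
      (1 - cB) • T2Of d Lc cE cVH cΛ cE₂ 0 T B mixFF j + cB • T2Of d Lc cE cVH cΛ cE₂ 1 T B mixFF j
  | 0 => by
    funext κ u κ' u' x z a b
    simp only [T2Of_zero, Pi.add_apply, Pi.smul_apply, smul_eq_mul]
    ring
  | j + 1 => by
    have IH := T2Of_borderWeight_affine hLc cE cVH cΛ cE₂ cB T hB hmix j
    obtain ⟨C0, δ0, hδ0, hL0⟩ := T2Of_loc (d := d) hLc cE cVH cΛ cE₂ 0 T hB hmix j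
    obtain ⟨C1, δ1, hδ1, hL1⟩ := T2Of_loc (d := d) hLc cE cVH cΛ cE₂ 1 T hB hmix j
    obtain ⟨δK, CK, hδK, -, hK⟩ := decays_KInvStep (Lc := Lc) (d := d) j
    have hC0 : 0 ≤ C0 := (abs_nonneg _).trans (abs_le_of_locStencil₂ hL0 hδ0.le 0 0 0 0 0 0 (Sum.inl 0) (Sum.inl 0))
    have hC1 : 0 ≤ C1 := (abs_nonneg _).trans (abs_le_of_locStencil₂ hL1 hδ1.le 0 0 0 0 0 0 (Sum.inl 0) (Sum.inl 0))
    have hb0 : ∀ κ u κ' u' x z a b, |((1 - cB) • T2Of d Lc cE cVH cΛ cE₂ 0 T B mixFF j) κ u κ' u' x z a b| ≤ |1 - cB| * C0 + |cB| * C1 :=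
      fun κ u κ' u' x z a b => abs_smul_le_of_locStencil₂ (1 - cB) hL0 hδ0.le
        (le_add_of_nonneg_right (mul_nonneg (abs_nonneg _) hC1)) κ u κ' u' x z a b
    have hb1 : ∀ κ u κ' u' x z a b, |(cB • T2Of d Lc cE cVH cΛ cE₂ 1 T B mixFF j) κ u κ' u' x z a b| ≤ |1 - cB| * C0 + |cB| * C1 :=
      fun κ u κ' u' x z a b => abs_smul_le_of_locStencil₂ cB hL1 hδ1.le
        (le_add_of_nonneg_left (mul_nonneg (abs_nonneg _) hC0)) κ u κ' u' x z a b
    have hlin : lin4 1 (KInvStep (d := d) Lc j) Lc (T2Of d Lc cE cVH cΛ cE₂ cB T B mixFF j) =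
        (1 - cB) • lin4 1 (KInvStep (d := d) Lc j) Lc (T2Of d Lc cE cVH cΛ cE₂ 0 T B mixFF j) +
          cB • lin4 1 (KInvStep (d := d) Lc j) Lc (T2Of d Lc cE cVH cΛ cE₂ 1 T B mixFF j) := by
      rw [IH, lin4_add hK hδK 1 Lc hb0 hb1, lin4_smul, lin4_smul]
    funext κ u κ' u' x z a b
    simp only [T2Of_succ, Pi.add_apply, Pi.smul_apply]
    rw [e4OfW_WbalOf_eq_base_add_lin4 hLc cE cVH cΛ (T2Of_loc (d := d) hLc cE cVH cΛ cE₂ cB T hB hmix) hmix j,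
      e4OfW_WbalOf_eq_base_add_lin4 hLc cE cVH cΛ (T2Of_loc (d := d) hLc cE cVH cΛ cE₂ 0 T hB hmix) hmix j,
      e4OfW_WbalOf_eq_base_add_lin4 hLc cE cVH cΛ (T2Of_loc (d := d) hLc cE cVH cΛ cE₂ 1 T hB hmix) hmix j, hlin]
    simp only [Pi.add_apply, Pi.smul_apply, smul_eq_mul]
    ring

/-! ## §3 The assembled second-order family is AFFINE in the border weight -/

/-- [folklore] **`WbalOf … (T2Of … cB …) … j` IS AFFINE IN `cB`**: the symmetrised carrier is the `T₂`-free part plus `vsym` of the bi-stencil slot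
(`W2SymOfK_eq_add_vsym`), `vsym` is additive on bounded tables and homogeneous (`Lin4Additive.vsym_add ∕ vsym_smul`), and §2. -/
theorem WbalOf_T2Of_borderWeight_affine (hLc : 1 ≤ Lc) (cE cVH cΛ cE₂ cB : ℝ) (T : Fin 4 → Fin 4 → Fin 4 → Fin 4 → ℝ)
    {B : Fin (d + 1) → (Fin (d + 1) → ℤ) → Fin (d + 1) → (Fin (d + 1) → ℤ) → MKer (d + 1) (Fib d)}
    (hB : ∃ C δ : ℝ, 0 < δ ∧ LocStencil₂ B C δ)
    {mixFF : Fin (d + 1) → (Fin (d + 1) → ℤ) → Fin (d + 1) → (Fin (d + 1) → ℤ) → MKer (d + 1) (Fib d)}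
    (hmix : ∃ C δ : ℝ, 0 < δ ∧ LocStencilFM Lc mixFF C δ) (j : ℕ) :
    WbalOf d Lc cE cVH cΛ (T2Of d Lc cE cVH cΛ cE₂ cB T B mixFF) mixFF j =
      (1 - cB) • WbalOf d Lc cE cVH cΛ (T2Of d Lc cE cVH cΛ cE₂ 0 T B mixFF) mixFF j +
        cB • WbalOf d Lc cE cVH cΛ (T2Of d Lc cE cVH cΛ cE₂ 1 T B mixFF) mixFF j := by
  obtain ⟨C0, δ0, hδ0, hL0⟩ := T2Of_loc (d := d) hLc cE cVH cΛ cE₂ 0 T hB hmix j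
  obtain ⟨C1, δ1, hδ1, hL1⟩ := T2Of_loc (d := d) hLc cE cVH cΛ cE₂ 1 T hB hmix j
  obtain ⟨δK, CK, hδK, -, hK⟩ := decays_KInvStep (Lc := Lc) (d := d) j
  have hC0 : 0 ≤ C0 := (abs_nonneg _).trans (abs_le_of_locStencil₂ hL0 hδ0.le 0 0 0 0 0 0 (Sum.inl 0) (Sum.inl 0))
  have hC1 : 0 ≤ C1 := (abs_nonneg _).trans (abs_le_of_locStencil₂ hL1 hδ1.le 0 0 0 0 0 0 (Sum.inl 0) (Sum.inl 0))
  have hb0 : ∀ κ u κ' u' x z a b, |((1 - cB) • T2Of d Lc cE cVH cΛ cE₂ 0 T B mixFF j) κ u κ' u' x z a b| ≤ |1 - cB| * C0 + |cB| * C1 :=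
    fun κ u κ' u' x z a b => abs_smul_le_of_locStencil₂ (1 - cB) hL0 hδ0.le
      (le_add_of_nonneg_right (mul_nonneg (abs_nonneg _) hC1)) κ u κ' u' x z a b
  have hb1 : ∀ κ u κ' u' x z a b, |(cB • T2Of d Lc cE cVH cΛ cE₂ 1 T B mixFF j) κ u κ' u' x z a b| ≤ |1 - cB| * C0 + |cB| * C1 :=
    fun κ u κ' u' x z a b => abs_smul_le_of_locStencil₂ cB hL1 hδ1.le
      (le_add_of_nonneg_left (mul_nonneg (abs_nonneg _) hC0)) κ u κ' u' x z a b
  unfold BalabanStepW2.WbalOf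
  rw [W2SymOfK_eq_add_vsym (KInvStep (d := d) Lc j) Lc _ _ (T2Of d Lc cE cVH cΛ cE₂ cB T B mixFF j),
    W2SymOfK_eq_add_vsym (KInvStep (d := d) Lc j) Lc _ _ (T2Of d Lc cE cVH cΛ cE₂ 0 T B mixFF j),
    W2SymOfK_eq_add_vsym (KInvStep (d := d) Lc j) Lc _ _ (T2Of d Lc cE cVH cΛ cE₂ 1 T B mixFF j),
    T2Of_borderWeight_affine hLc cE cVH cΛ cE₂ cB T hB hmix j]
  funext μ y ν y' x z a b
  simp only [Pi.add_apply, Pi.smul_apply, smul_eq_mul]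
  rw [vsym_add hK hδK Lc hb0 hb1, vsym_smul, vsym_smul]
  simp only [Pi.add_apply, Pi.smul_apply, smul_eq_mul]
  ring

/-! ## §4 The one-step Hessian kernel is affine in its second-order slot; at `d = 3` so are the pinned literal's step kernels and coefficients -/

section Kernel

variable {D : ℕ} {F : Type*} [Fintype F]

/-- [folklore] **`hessKer` IS AFFINE IN THE W-SLOT** (spread leg `A`; the bond-pair members localised): the tadpole is additive (`TameKernelCalculus.tadpole_add`) and
homogeneous (`KernelReflection.tadpole_smul`), the bubble does not see `W`. -/
theorem hessKer_affine_W {A : MKer D F} (hA : Spr A) (V : Fin D → (Fin D → ℤ) → MKer D F)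
    {W₀ W₁ : Fin D → (Fin D → ℤ) → Fin D → (Fin D → ℤ) → MKer D F} (c : ℝ) (μ ν : Fin D) (z : Fin D → ℤ)
    (h₀ : Loc (W₀ μ 0 ν z)) (h₁ : Loc (W₁ μ 0 ν z)) :
    hessKer A V ((1 - c) • W₀ + c • W₁) μ ν z = (1 - c) * hessKer A V W₀ μ ν z + c * hessKer A V W₁ μ ν z := by
  simp only [ExpKernelCalculus.hessKer, Pi.add_apply, Pi.smul_apply]
  rw [tadpole_add hA (h₀.smul (1 - c)) (h₁.smul c), tadpole_smul, tadpole_smul]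
  ring

end Kernel

section Pinned

variable {Lc : ℕ} [NeZero Lc] {r : Fin (3 + 1) → ℕ}

/-- [folklore] The first-order part of an2's jet datum does not depend on the second-order tables or their certificates. -/
theorem JsBal0Of_S_indep (hLc : 1 ≤ Lc) (cE cVH cΛ : ℝ)
    (W W' : ℕ → Fin (3 + 1) → (Fin (3 + 1) → ℤ) → Fin (3 + 1) → (Fin (3 + 1) → ℤ) → MKer (3 + 1) (Fib 3))
    (Cw δw : ℕ → ℝ) (hδw : ∀ j, 0 < δw j) (hW : ∀ j, VertexFamily₂ (W j) Lc (Cw j) (δw j))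
    (Cw' δw' : ℕ → ℝ) (hδw' : ∀ j, 0 < δw' j) (hW' : ∀ j, VertexFamily₂ (W' j) Lc (Cw' j) (δw' j)) :
    ∀ j : ℕ, (JsBal0Of hLc cE cVH cΛ W Cw δw hδw hW j).S = (JsBal0Of hLc cE cVH cΛ W' Cw' δw' hδw' hW' j).S
  | 0 => rfl
  | _ + 1 => rfl

/-- [folklore] **THE PINNED LITERAL's STEP KERNELS ARE AFFINE IN THE BORDER WEIGHT** (any `cE₂`, any box root, every level, every entry):
`TbalOf Lc (JsBalAn1 … cB …) j μ ν z = (1 − cB)·TbalOf Lc (JsBalAn1 … 0 …) j μ ν z + cB·TbalOf Lc (JsBalAn1 … 1 …) j μ ν z` — an1's closed form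
`TbalOf_JsBalAn1`, the `cB`-free first-order part, §3 for the tables, `hessKer_affine_W` with `Spr (axDressK Lc (KInvStep Lc j))` (`decays_KInvStep`,
`decays_axDressK`) and the bond-pair localisation of an2's `WbalOf` (`vertexFamily₂_WbalOf'`). -/
theorem TbalOf_JsBalAn1_borderWeight_affine (hLc : 1 ≤ Lc) (hr : r ∈ box (3 + 1) Lc) (cE cVH cΛ cE₂ cB : ℝ)
    (T : Fin 4 → Fin 4 → Fin 4 → Fin 4 → ℝ) (j : ℕ) (μ ν : Fin 4) (z : Fin 4 → ℤ) :
    TbalOf Lc (JsBalAn1 hLc hr cE cVH cΛ cE₂ cB T) j μ ν z =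
      (1 - cB) * TbalOf Lc (JsBalAn1 hLc hr cE cVH cΛ cE₂ 0 T) j μ ν z + cB * TbalOf Lc (JsBalAn1 hLc hr cE cVH cΛ cE₂ 1 T) j μ ν z := by
  rw [TbalOf_JsBalAn1 hLc hr cE cVH cΛ cE₂ cB T j, TbalOf_JsBalAn1 hLc hr cE cVH cΛ cE₂ 0 T j, TbalOf_JsBalAn1 hLc hr cE cVH cΛ cE₂ 1 T j]
  rw [JsBal0Of_S_indep hLc cE cVH cΛ (WbalT2Of (Lc := Lc) cE cVH cΛ cE₂ cB T (vh₂S := vh₂SAt (toSite r) Lc) (mixFF := mixFFAt (toSite r) Lc))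
      (WbalT2Of (Lc := Lc) cE cVH cΛ cE₂ 1 T (vh₂S := vh₂SAt (toSite r) Lc) (mixFF := mixFFAt (toSite r) Lc)) _ _ _ _ _ _ _ _ j,
    JsBal0Of_S_indep hLc cE cVH cΛ (WbalT2Of (Lc := Lc) cE cVH cΛ cE₂ 0 T (vh₂S := vh₂SAt (toSite r) Lc) (mixFF := mixFFAt (toSite r) Lc))
      (WbalT2Of (Lc := Lc) cE cVH cΛ cE₂ 1 T (vh₂S := vh₂SAt (toSite r) Lc) (mixFF := mixFFAt (toSite r) Lc)) _ _ _ _ _ _ _ _ j]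
  have hW : WbalT2Of (Lc := Lc) cE cVH cΛ cE₂ cB T (vh₂S := vh₂SAt (toSite r) Lc) (mixFF := mixFFAt (toSite r) Lc) j =
      (1 - cB) • WbalT2Of (Lc := Lc) cE cVH cΛ cE₂ 0 T (vh₂S := vh₂SAt (toSite r) Lc) (mixFF := mixFFAt (toSite r) Lc) j +
        cB • WbalT2Of (Lc := Lc) cE cVH cΛ cE₂ 1 T (vh₂S := vh₂SAt (toSite r) Lc) (mixFF := mixFFAt (toSite r) Lc) j :=
    WbalOf_T2Of_borderWeight_affine hLc cE cVH cΛ cE₂ cB T (hB_an1 hLc hr) (hmix_an1 hLc hr) j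
  rw [hW]
  obtain ⟨δK, CK, hδK, -, hK⟩ := decays_KInvStep (Lc := Lc) (d := 3) j
  have hA : Spr (axDressK Lc (KInvStep (d := 3) Lc j)) := ⟨_, δK, hδK, decays_axDressK hLc hK hδK.le⟩
  obtain ⟨Cw0, δw0, hδw0, hW0⟩ := vertexFamily₂_WbalOf' (d := 3) hLc cE cVH cΛ
    (T2Of_loc (d := 3) hLc cE cVH cΛ cE₂ 0 T (hB_an1 hLc hr) (hmix_an1 hLc hr)) (hmix_an1 hLc hr) j
  obtain ⟨Cw1, δw1, hδw1, hW1⟩ := vertexFamily₂_WbalOf' (d := 3) hLc cE cVH cΛ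
    (T2Of_loc (d := 3) hLc cE cVH cΛ cE₂ 1 T (hB_an1 hLc hr) (hmix_an1 hLc hr)) (hmix_an1 hLc hr) j
  exact hessKer_affine_W hA _ cB μ ν z ⟨_, _, _, _, hδw0, hW0 μ 0 ν z⟩ ⟨_, _, _, _, hδw1, hW1 μ 0 ν z⟩

/-- [folklore] **THE PINNED LITERAL's ONE-LOOP STEP COEFFICIENTS ARE AFFINE IN THE BORDER WEIGHT — the hypothesis `haff` of `Gaps/D1PinnedBorderWeightSocket`
DISCHARGED** (any `cE₂`, any box root, every level, every channel):
`secondMoment (TbalOf Lc (JsBalAn1 … cB …) j) μ ν = (1 − cB)·secondMoment (TbalOf Lc (JsBalAn1 … 0 …) j) μ ν + cB·secondMoment (TbalOf Lc (JsBalAn1 … 1 …) j) μ ν`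
(`ScalewiseWitness.secondMoment_add ∕ secondMoment_smul`, absolute moments by `OneStepKernelFamily.hTA_TbalOf`). -/
theorem secondMoment_JsBalAn1_borderWeight_affine (hLc : 1 ≤ Lc) (hr : r ∈ box (3 + 1) Lc) (cE cVH cΛ cE₂ cB : ℝ)
    (T : Fin 4 → Fin 4 → Fin 4 → Fin 4 → ℝ) (j : ℕ) (μ ν : Fin 4) :
    B12Beta.secondMoment (TbalOf Lc (JsBalAn1 hLc hr cE cVH cΛ cE₂ cB T) j) μ ν =
      (1 - cB) * B12Beta.secondMoment (TbalOf Lc (JsBalAn1 hLc hr cE cVH cΛ cE₂ 0 T) j) μ ν +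
        cB * B12Beta.secondMoment (TbalOf Lc (JsBalAn1 hLc hr cE cVH cΛ cE₂ 1 T) j) μ ν := by
  have hker : TbalOf Lc (JsBalAn1 hLc hr cE cVH cΛ cE₂ cB T) j =
      (1 - cB) • TbalOf Lc (JsBalAn1 hLc hr cE cVH cΛ cE₂ 0 T) j + cB • TbalOf Lc (JsBalAn1 hLc hr cE cVH cΛ cE₂ 1 T) j := by
    funext μ' ν' z
    simp only [Pi.add_apply, Pi.smul_apply, smul_eq_mul]
    exact TbalOf_JsBalAn1_borderWeight_affine hLc hr cE cVH cΛ cE₂ cB T j μ' ν' z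
  have h0 : ∀ c e, DecimatedMomentSummable.AbsMoment₂ (((1 - cB) • TbalOf Lc (JsBalAn1 hLc hr cE cVH cΛ cE₂ 0 T) j) c e) :=
    fun c e => absMoment₂_const_mul (hTA_TbalOf (JsBalAn1 hLc hr cE cVH cΛ cE₂ 0 T) j c e) (1 - cB)
  have h1 : ∀ c e, DecimatedMomentSummable.AbsMoment₂ ((cB • TbalOf Lc (JsBalAn1 hLc hr cE cVH cΛ cE₂ 1 T) j) c e) :=
    fun c e => absMoment₂_const_mul (hTA_TbalOf (JsBalAn1 hLc hr cE cVH cΛ cE₂ 1 T) j c e) cB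
  rw [hker, secondMoment_add h0 h1, secondMoment_smul, secondMoment_smul]

end Pinned

/-! ## §5 UNCONDITIONAL consequences at the pin `cE₂ := Lc^8`, `2 ≤ Lc`: the limit is affine in `cB`; (D1) at the pinned literal is `cB`-blind or DEFINES `cB` -/

section Consequences

variable {Lc : ℕ} [NeZero Lc] {r : Fin (3 + 1) → ℕ}

/-- [folklore] **THE LIMIT OF THE PINNED LITERAL's ONE-LOOP COEFFICIENTS IS AFFINE IN THE BORDER WEIGHT, HYPOTHESIS-FREE**:
`lim β⁰(cB) = (1 − cB)·lim β⁰(0) + cB·lim β⁰(1)` (§4 at every level + gan24-p1's convergence via g1-p3's `tendsto_pinned` + `tendsto_nhds_unique`). -/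
theorem lim_JsBalAn1_borderWeight_affine (hLc : 2 ≤ Lc) (hr : r ∈ box (3 + 1) Lc) (cE cVH cΛ cB : ℝ)
    (Tc : Fin 4 → Fin 4 → Fin 4 → Fin 4 → ℝ) (μ ν : Fin 4) :
    CauchyRate.lim (fun j => B12Beta.secondMoment (TbalOf Lc (JsBalAn1 (one_le_of_two_le hLc) hr cE cVH cΛ ((Lc : ℝ) ^ (2 * (3 + 1))) cB Tc) j) μ ν) =
      (1 - cB) * CauchyRate.lim (fun j => B12Beta.secondMoment (TbalOf Lc (JsBalAn1 (one_le_of_two_le hLc) hr cE cVH cΛ ((Lc : ℝ) ^ (2 * (3 + 1))) 0 Tc) j) μ ν) +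
        cB * CauchyRate.lim (fun j => B12Beta.secondMoment (TbalOf Lc (JsBalAn1 (one_le_of_two_le hLc) hr cE cVH cΛ ((Lc : ℝ) ^ (2 * (3 + 1))) 1 Tc) j) μ ν) := by
  have hc := tendsto_pinned hLc hr cE cVH cΛ cB Tc μ ν
  have h0 := tendsto_pinned hLc hr cE cVH cΛ 0 Tc μ ν
  have h1 := tendsto_pinned hLc hr cE cVH cΛ 1 Tc μ ν
  have h' := (h0.const_mul (1 - cB)).add (h1.const_mul cB)
  exact tendsto_nhds_unique hc (h'.congr fun j =>
    (secondMoment_JsBalAn1_borderWeight_affine (one_le_of_two_le hLc) hr cE cVH cΛ _ cB Tc j μ ν).symm)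

/-- [folklore] **BLIND CASE**: if `lim β⁰(cB := 1) = lim β⁰(cB := 0)` then, for every numeral and every border weight, (D1) at the pinned literal does not see `cB`:
`D1Drift Lc (JsBalAn1 … cB …) N μ ν ↔ D1Drift Lc (JsBalAn1 … 0 …) N μ ν` (g1-p3's `d1Drift_pinned_iff_lim_eq` twice). -/
theorem d1Drift_JsBalAn1_iff_zero_of_blind (hLc : 2 ≤ Lc) (hr : r ∈ box (3 + 1) Lc) (cE cVH cΛ : ℝ)
    (Tc : Fin 4 → Fin 4 → Fin 4 → Fin 4 → ℝ) (μ ν : Fin 4)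
    (hblind : CauchyRate.lim (fun j => B12Beta.secondMoment (TbalOf Lc (JsBalAn1 (one_le_of_two_le hLc) hr cE cVH cΛ ((Lc : ℝ) ^ (2 * (3 + 1))) 1 Tc) j) μ ν) =
      CauchyRate.lim (fun j => B12Beta.secondMoment (TbalOf Lc (JsBalAn1 (one_le_of_two_le hLc) hr cE cVH cΛ ((Lc : ℝ) ^ (2 * (3 + 1))) 0 Tc) j) μ ν))
    (cB N : ℝ) :
    D1Drift Lc (JsBalAn1 (one_le_of_two_le hLc) hr cE cVH cΛ ((Lc : ℝ) ^ (2 * (3 + 1))) cB Tc) N μ ν ↔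
      D1Drift Lc (JsBalAn1 (one_le_of_two_le hLc) hr cE cVH cΛ ((Lc : ℝ) ^ (2 * (3 + 1))) 0 Tc) N μ ν := by
  rw [d1Drift_pinned_iff_lim_eq hLc hr cE cVH cΛ cB Tc μ ν N, d1Drift_pinned_iff_lim_eq hLc hr cE cVH cΛ 0 Tc μ ν N,
    lim_JsBalAn1_borderWeight_affine hLc hr cE cVH cΛ cB Tc μ ν, hblind]
  constructor
  · intro h; linear_combination h
  · intro h; linear_combination h

/-- [folklore] **GENERIC CASE, SURJECTIVITY**: if `lim β⁰(1) ≠ lim β⁰(0)` then the limit takes EVERY real value along the `cB`-line (hypothesis-free). -/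
theorem exists_borderWeight_lim_eq (hLc : 2 ≤ Lc) (hr : r ∈ box (3 + 1) Lc) (cE cVH cΛ : ℝ)
    (Tc : Fin 4 → Fin 4 → Fin 4 → Fin 4 → ℝ) (μ ν : Fin 4)
    (hgen : CauchyRate.lim (fun j => B12Beta.secondMoment (TbalOf Lc (JsBalAn1 (one_le_of_two_le hLc) hr cE cVH cΛ ((Lc : ℝ) ^ (2 * (3 + 1))) 1 Tc) j) μ ν) ≠
      CauchyRate.lim (fun j => B12Beta.secondMoment (TbalOf Lc (JsBalAn1 (one_le_of_two_le hLc) hr cE cVH cΛ ((Lc : ℝ) ^ (2 * (3 + 1))) 0 Tc) j) μ ν))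
    (t : ℝ) :
    ∃ cB : ℝ, CauchyRate.lim (fun j => B12Beta.secondMoment (TbalOf Lc (JsBalAn1 (one_le_of_two_le hLc) hr cE cVH cΛ ((Lc : ℝ) ^ (2 * (3 + 1))) cB Tc) j) μ ν) = t := by
  refine ⟨(t - CauchyRate.lim (fun j => B12Beta.secondMoment (TbalOf Lc (JsBalAn1 (one_le_of_two_le hLc) hr cE cVH cΛ ((Lc : ℝ) ^ (2 * (3 + 1))) 0 Tc) j) μ ν)) /
      (CauchyRate.lim (fun j => B12Beta.secondMoment (TbalOf Lc (JsBalAn1 (one_le_of_two_le hLc) hr cE cVH cΛ ((Lc : ℝ) ^ (2 * (3 + 1))) 1 Tc) j) μ ν) -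
        CauchyRate.lim (fun j => B12Beta.secondMoment (TbalOf Lc (JsBalAn1 (one_le_of_two_le hLc) hr cE cVH cΛ ((Lc : ℝ) ^ (2 * (3 + 1))) 0 Tc) j) μ ν)), ?_⟩
  rw [lim_JsBalAn1_borderWeight_affine hLc hr cE cVH cΛ _ Tc μ ν]
  have hne := sub_ne_zero.mpr hgen
  field_simp
  ring

/-- [folklore] **GENERIC CASE: (D1) AT THE PINNED LITERAL DEFINES THE BORDER WEIGHT, HYPOTHESIS-FREE** — if `lim β⁰(1) ≠ lim β⁰(0)` then for EVERY numeral `N` there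
is EXACTLY ONE border weight `cB` with `D1Drift Lc (JsBalAn1 … cB …) N μ ν` (`cB⋆ = (stepBal N Lc − ℓ₀)∕(ℓ₁ − ℓ₀)`). -/
theorem existsUnique_borderWeight_d1Drift (hLc : 2 ≤ Lc) (hr : r ∈ box (3 + 1) Lc) (cE cVH cΛ : ℝ)
    (Tc : Fin 4 → Fin 4 → Fin 4 → Fin 4 → ℝ) (μ ν : Fin 4)
    (hgen : CauchyRate.lim (fun j => B12Beta.secondMoment (TbalOf Lc (JsBalAn1 (one_le_of_two_le hLc) hr cE cVH cΛ ((Lc : ℝ) ^ (2 * (3 + 1))) 1 Tc) j) μ ν) ≠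
      CauchyRate.lim (fun j => B12Beta.secondMoment (TbalOf Lc (JsBalAn1 (one_le_of_two_le hLc) hr cE cVH cΛ ((Lc : ℝ) ^ (2 * (3 + 1))) 0 Tc) j) μ ν))
    (N : ℝ) :
    ∃! cB : ℝ, D1Drift Lc (JsBalAn1 (one_le_of_two_le hLc) hr cE cVH cΛ ((Lc : ℝ) ^ (2 * (3 + 1))) cB Tc) N μ ν := by
  obtain ⟨cB, hcB⟩ := exists_borderWeight_lim_eq hLc hr cE cVH cΛ Tc μ ν hgen (B12Normalization.stepBal N Lc)
  refine ⟨cB, (d1Drift_pinned_iff_lim_eq hLc hr cE cVH cΛ cB Tc μ ν N).mpr hcB, fun cB' hcB' => ?_⟩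
  have h1 := (d1Drift_pinned_iff_lim_eq hLc hr cE cVH cΛ cB Tc μ ν N).mpr hcB
  have h2 := (d1Drift_pinned_iff_lim_eq hLc hr cE cVH cΛ cB' Tc μ ν N).mp hcB'
  have h1' := (d1Drift_pinned_iff_lim_eq hLc hr cE cVH cΛ cB Tc μ ν N).mp h1
  rw [lim_JsBalAn1_borderWeight_affine hLc hr cE cVH cΛ _ Tc μ ν] at h1' h2
  have hne := sub_ne_zero.mpr hgen
  have hkey : (cB' - cB) * (CauchyRate.lim (fun j => B12Beta.secondMoment (TbalOf Lc (JsBalAn1 (one_le_of_two_le hLc) hr cE cVH cΛ ((Lc : ℝ) ^ (2 * (3 + 1))) 1 Tc) j) μ ν) -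
      CauchyRate.lim (fun j => B12Beta.secondMoment (TbalOf Lc (JsBalAn1 (one_le_of_two_le hLc) hr cE cVH cΛ ((Lc : ℝ) ^ (2 * (3 + 1))) 0 Tc) j) μ ν)) = 0 := by
    linear_combination h2 - h1'
  rcases mul_eq_zero.mp hkey with h | h
  · linarith
  · exact absurd h hne

/-- [folklore] **GENERIC CASE: THE END BIT IS DECIDED BY THE BORDER WEIGHT, HYPOTHESIS-FREE** — if `lim β⁰(1) ≠ lim β⁰(0)` then some border weight makes
`0 < lim β⁰` (the headline's β-binder at this literal, `Gaps/D1PinnedLimitClosedForm.continuumYM4Torus_of_closedForm_pos`) hold and another makes it fail. -/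
theorem exists_borderWeight_limPos_and_limNeg (hLc : 2 ≤ Lc) (hr : r ∈ box (3 + 1) Lc) (cE cVH cΛ : ℝ)
    (Tc : Fin 4 → Fin 4 → Fin 4 → Fin 4 → ℝ) (μ ν : Fin 4)
    (hgen : CauchyRate.lim (fun j => B12Beta.secondMoment (TbalOf Lc (JsBalAn1 (one_le_of_two_le hLc) hr cE cVH cΛ ((Lc : ℝ) ^ (2 * (3 + 1))) 1 Tc) j) μ ν) ≠
      CauchyRate.lim (fun j => B12Beta.secondMoment (TbalOf Lc (JsBalAn1 (one_le_of_two_le hLc) hr cE cVH cΛ ((Lc : ℝ) ^ (2 * (3 + 1))) 0 Tc) j) μ ν)) :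
    (∃ cB : ℝ, 0 < CauchyRate.lim (fun j => B12Beta.secondMoment (TbalOf Lc (JsBalAn1 (one_le_of_two_le hLc) hr cE cVH cΛ ((Lc : ℝ) ^ (2 * (3 + 1))) cB Tc) j) μ ν)) ∧
    (∃ cB : ℝ, CauchyRate.lim (fun j => B12Beta.secondMoment (TbalOf Lc (JsBalAn1 (one_le_of_two_le hLc) hr cE cVH cΛ ((Lc : ℝ) ^ (2 * (3 + 1))) cB Tc) j) μ ν) < 0) := by
  obtain ⟨c₁, hc₁⟩ := exists_borderWeight_lim_eq hLc hr cE cVH cΛ Tc μ ν hgen 1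
  obtain ⟨c₂, hc₂⟩ := exists_borderWeight_lim_eq hLc hr cE cVH cΛ Tc μ ν hgen (-1)
  exact ⟨⟨c₁, by rw [hc₁]; exact one_pos⟩, ⟨c₂, by rw [hc₂]; norm_num⟩⟩

end Consequences

end Summit.QuantumFields.BalabanUV.Gaps.D1PinnedBorderWeightAffine

end
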